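import Mathlib.CategoryTheory.SingleObj
import Literature.AnabelianGeometry.EtaleTheta.TemperedFrobenioidToy
import Literature.AnabelianGeometry.EtaleTheta.TemperedFrobenioidCor38Sub
import Literature.AnabelianGeometry.EtaleTheta.Discharge.Sec3Thm37
import Literature.AlgebraicGeometry.Frobenioids.ModelFrobenioidPreFrobenioid
import Literature.AlgebraicGeometry.Frobenioids.PreFrobenioidDataOfFunctor
import HarnessLib

/-!
# [EtTh] Def. 3.6 data over the FSM-type one-object base `B(ℤ ⋊ ℕ≥1)` — the model Frobenioid of the degree ↔
# base-index swap (toy data; consumed by `TemperedFrobenioidCor38SubDegreeSwapNegative.lean`)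

S. Mochizuki, *The étale theta function …*, Publ. RIMS **45** (2009) [MochizukiEtTh2009], Def. 3.3 (iii) p. 73, Def. 3.6
(i)/(ii) pp. 76–77 [cite: MochizukiEtTh2009, Def 3.6 p.77]; S. Mochizuki, *The geometry of Frobenioids I*, Kyushu J. Math.
**62** (2008), §0 p. 14 (FSM-morphisms, categories of FSM-type), Thm. 5.2 (i) p. 100 (model Frobenioids)
[cite: MochizukiFrdI2008, Thm. 5.2 (i) p.100].

abc-iut cell, block F, seat abc-iut-w6-d020 (gen 5); DATA file for the kernel certificate deciding the bare closure of
FACT-LIST row F-2815 (`Cor38Hyp.PreservesLinear`).  Contents: the monoid `M = ℤ ⋊ ℕ≥1` and its one-object category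
`B(M)` — connected, totally epimorphic, of FSM-type (an FSM-morphism `(u,n)` is fiberwise surjective against `(u+1,n)`
only if `n ∣ 1`), NOT a groupoid; the typed Def. 3.3 (iii)/3.6 (i)/3.6 (ii) data with `Φ = Φ^{ℝ-log} = ℚ≥0` pulled back
along `(u,n)` by `w ↦ w/n`, `B₀^Λ = ℤ × (ℚ≥0)^gp`, `Div = pr₂`, `Λ = ℚ`, trivial [FrdI] vocabularies (every typed field
holds: `DegreeSwap.C`); the endomorphisms `mkEnd d g w k` of the Frobenius-trivial object `X₀` with their composition law
`(d₂d₁, g₂g₁, w₂/n₁ + d₂w₁, k₂ + d₂k₁)` (`mkEnd_comp`), the coordinates `wOf`/`kOf` of an arrow, and the arrows `homOf`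
with prescribed `(d, g, z, u)`.  A toy inhabitant of typed interfaces, not a tempered Frobenioid of a curve.  HONEST
FRAMING: nothing here bears on the disputed [IUTchIII] Cor. 3.12; no side taken; typed ≠ proved. -/

noncomputable section

namespace Literature.AnabelianGeometry.EtaleTheta

open CategoryTheory Opposite Literature.AlgebraicGeometry.Frobenioids

namespace DegreeSwap

/-- `M := ℤ ⋊ ℕ≥1`, `(u₂,n₂)·(u₁,n₁) = (u₂ + n₂u₁, n₂n₁)` (affine maps `x ↦ nx + u`). [cite: MochizukiFrdI2008, §0 p.14] -/
@[ext] structure M : Type where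
  /-- translation part -/
  u : ℤ
  /-- index part -/
  n : ℕ+

namespace M

/-- The semidirect multiplication `(u₂,n₂)·(u₁,n₁) = (u₂ + n₂u₁, n₂n₁)` (NEW concrete data, not an instance on a
tree structure). [cite: MochizukiFrdI2008, §0 p.14] -/
instance : Mul M := ⟨fun a b => ⟨a.u + (a.n : ℤ) * b.u, a.n * b.n⟩⟩
/-- The unit `(0, 1)`. [cite: MochizukiFrdI2008, §0 p.14] -/
instance : One M := ⟨⟨0, 1⟩⟩

/-- Components of products. [cite: MochizukiFrdI2008, §0 p.14] -/
@[simp] theorem mul_u (a b : M) : (a * b).u = a.u + (a.n : ℤ) * b.u := rfl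
/-- Components of products. [cite: MochizukiFrdI2008, §0 p.14] -/
@[simp] theorem mul_n (a b : M) : (a * b).n = a.n * b.n := rfl
/-- Components of the unit. [cite: MochizukiFrdI2008, §0 p.14] -/
@[simp] theorem one_u : (1 : M).u = 0 := rfl
/-- Components of the unit. [cite: MochizukiFrdI2008, §0 p.14] -/
@[simp] theorem one_n : (1 : M).n = 1 := rfl

/-- `M = ℤ ⋊ ℕ≥1` is a monoid. [cite: MochizukiFrdI2008, §0 p.14] -/
instance : Monoid M where
  mul_assoc a b c := by
    ext
    · simp only [mul_u, mul_n, PNat.mul_coe, Nat.cast_mul]; ring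
    · simp only [mul_n, mul_assoc]
  one_mul a := by ext <;> simp
  mul_one a := by ext <;> simp

end M

/-- The base category `D = D₀ := B(M)`. [cite: MochizukiFrdI2008, §0 p.14] -/
abbrev D : Type := SingleObj M

/-- Composition in `B(M)` on components. [cite: MochizukiFrdI2008, §0 p.14] -/
theorem comp_u {x y z : D} (f : x ⟶ y) (g : y ⟶ z) : M.u (f ≫ g) = M.u g + (M.n g : ℤ) * M.u f := rfl

/-- Composition in `B(M)` on components. [cite: MochizukiFrdI2008, §0 p.14] -/
theorem comp_n {x y z : D} (f : x ⟶ y) (g : y ⟶ z) : M.n (f ≫ g) = M.n g * M.n f := rfl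

/-- Identities of `B(M)` on components. [cite: MochizukiFrdI2008, §0 p.14] -/
theorem id_u (x : D) : M.u (𝟙 x) = 0 := rfl

/-- Identities of `B(M)` on components. [cite: MochizukiFrdI2008, §0 p.14] -/
theorem id_n (x : D) : M.n (𝟙 x) = 1 := rfl

/-- A unit `(u,1)` of `M` is an isomorphism of `B(M)` (inverse `(-u,1)`). [cite: MochizukiFrdI2008, §0 p.14] -/
theorem isIso_of_n_eq_one {A B : D} (f : A ⟶ B) (hf : M.n f = 1) : IsIso f := by
  refine ⟨⟨(⟨-(M.u f), 1⟩ : M), ?_, ?_⟩⟩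
  · apply M.ext
    · rw [comp_u, id_u]; dsimp only; rw [PNat.one_coe, Nat.cast_one, one_mul, neg_add_cancel]
    · rw [comp_n, id_n]; dsimp only; rw [hf, mul_one]
  · apply M.ext
    · rw [comp_u, id_u, hf]; dsimp only; rw [PNat.one_coe, Nat.cast_one, one_mul, add_neg_cancel]
    · rw [comp_n, id_n, hf]; dsimp only; rw [mul_one]

/-- **`B(ℤ ⋊ ℕ≥1)` is of FSM-type**: fiberwise surjectivity of `(u,n)` against `(u+1,n)` forces `n ∣ 1`. [cite: MochizukiFrdI2008, §0 p.14] -/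
theorem isOfFSMType : IsOfFSMType D where
  isIso_of_isFSM {A B} f hf := by
    obtain ⟨X, δB, δX, h⟩ := hf.1 (show A ⟶ B from (⟨M.u f + 1, M.n f⟩ : M))
    have hu : M.u f + ((M.n f : ℕ) : ℤ) * M.u δB = (M.u f + 1) + ((M.n f : ℕ) : ℤ) * M.u δX := congrArg M.u h
    have key : ((M.n f : ℕ) : ℤ) * (M.u δB - M.u δX) = 1 := by rw [mul_sub]; linarith
    have h1 : ((M.n f : ℕ) : ℤ) = 1 := Int.eq_one_of_mul_eq_one_right (by positivity) key
    exact isIso_of_n_eq_one f (PNat.coe_inj.1 (by exact_mod_cast h1))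

/-- `B(M)` is totally epimorphic (`M` is right-cancellative). [cite: MochizukiFrdI2008, §0 p.15] -/
theorem isTotallyEpimorphic : IsTotallyEpimorphic D :=
  ⟨fun f => ⟨fun g h w => by
    have hn : M.n g = M.n h := mul_right_cancel (congrArg M.n w : M.n g * M.n f = M.n h * M.n f)
    have hu : M.u g + ((M.n g : ℕ) : ℤ) * M.u f = M.u h + ((M.n h : ℕ) : ℤ) * M.u f := congrArg M.u w
    rw [hn] at hu
    exact M.ext (by linarith) hn⟩⟩

/-- `ℚ≥0` written multiplicatively. [cite: MochizukiEtTh2009, Def 3.6 p.76] -/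
abbrev W : Type := Multiplicative ℚ≥0
/-- Scaling `w ↦ q·w` of `ℚ≥0` as a monoid endomorphism. [cite: MochizukiEtTh2009, Def 3.6 p.76] -/
def scale (q : ℚ≥0) : W →* W where
  toFun x := Multiplicative.ofAdd (q * Multiplicative.toAdd x)
  map_one' := by simp
  map_mul' x y := by rw [toAdd_mul, mul_add, ofAdd_add]

/-- Values of `scale`. [cite: MochizukiEtTh2009, Def 3.6 p.76] -/
theorem scale_apply (q : ℚ≥0) (x : W) : scale q x = Multiplicative.ofAdd (q * Multiplicative.toAdd x) := rfl

/-- `scale 1 = id`. [cite: MochizukiEtTh2009, Def 3.6 p.76] -/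
theorem scale_one : scale 1 = MonoidHom.id W :=
  MonoidHom.ext fun x => by rw [scale_apply, one_mul]; rfl

/-- `scale (pq) = scale p ∘ scale q`. [cite: MochizukiEtTh2009, Def 3.6 p.76] -/
theorem scale_mul (p q : ℚ≥0) : scale (p * q) = (scale p).comp (scale q) :=
  MonoidHom.ext fun x => by rw [MonoidHom.comp_apply, scale_apply, scale_apply, scale_apply, toAdd_ofAdd, mul_assoc]

/-- `scale q (w₂) · w₁^d = q·w₂ + d·w₁` (additively). [cite: MochizukiEtTh2009, Def 3.6 p.76] -/
theorem scale_mul_pow (q w₂ w₁ : ℚ≥0) (d : ℕ) :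
    scale q (Multiplicative.ofAdd w₂) * Multiplicative.ofAdd w₁ ^ d = Multiplicative.ofAdd (q * w₂ + (d : ℚ≥0) * w₁) := by
  rw [scale_apply, toAdd_ofAdd, ← ofAdd_nsmul, ← ofAdd_add, nsmul_eq_mul]

/-- `1/n` of `(u,n) ∈ M`. [cite: MochizukiEtTh2009, Def 3.6 p.76] -/
def ninv (g : M) : ℚ≥0 := (((M.n g : ℕ) : ℚ≥0))⁻¹

/-- `1/n` along a composite. [cite: MochizukiEtTh2009, Def 3.6 p.76] -/
theorem ninv_comp {x y z : D} (f : x ⟶ y) (g : y ⟶ z) : ninv (f ≫ g) = ninv f * ninv g := by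
  unfold ninv; rw [comp_n, PNat.mul_coe, Nat.cast_mul, mul_inv, mul_comm]

/-- `1/n` of an identity. [cite: MochizukiEtTh2009, Def 3.6 p.76] -/
theorem ninv_id (x : D) : ninv (𝟙 x) = 1 := by
  unfold ninv; rw [id_n, PNat.one_coe, Nat.cast_one, inv_one]

/-- `Φ^{ℝ-log} := ℚ≥0` on `B(M)`, pulled back along `(u,n)` by `w ↦ w/n`. [cite: MochizukiEtTh2009, Def 3.6 p.76] -/
def ΦR : Dᵒᵖ ⥤ CommMonCat.{0} where
  obj _ := CommMonCat.of W
  map f := CommMonCat.ofHom (scale (ninv f.unop))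
  map_id A := by
    apply CommMonCat.hom_ext
    rw [CommMonCat.hom_ofHom, CommMonCat.hom_id, unop_id, ninv_id, scale_one]
  map_comp f g := by
    apply CommMonCat.hom_ext
    rw [CommMonCat.hom_comp, CommMonCat.hom_ofHom, CommMonCat.hom_ofHom, CommMonCat.hom_ofHom, unop_comp, ninv_comp,
      scale_mul]

/-- `gpMap id = id`, pointwise. [folklore] -/
private theorem gpMap_id_apply {N : Type} [CommMonoid N] (x : Algebra.GrothendieckGroup N) :
    Literature.AlgebraicGeometry.Frobenioids.gpMap (MonoidHom.id N) x = x :=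
  DFunLike.congr_fun (Literature.AlgebraicGeometry.Frobenioids.gpMap_id (M := N)) x

/-- `B₀^Λ := ℤ × (ℚ≥0)^gp` (units `ℤ` with divisor `0`; the second factor scaled like `Φ`). [cite: MochizukiEtTh2009, Def 3.6 p.76] -/
def BΛ : Dᵒᵖ ⥤ CommMonCat.{0} where
  obj _ := CommMonCat.of (Multiplicative ℤ × Algebra.GrothendieckGroup W)
  map f := CommMonCat.ofHom
    ((MonoidHom.id _).prodMap (Literature.AlgebraicGeometry.Frobenioids.gpMap (ΦR.map f).hom))
  map_id A := by
    apply CommMonCat.hom_ext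
    refine MonoidHom.ext fun x => Prod.ext rfl ?_
    change Literature.AlgebraicGeometry.Frobenioids.gpMap (ΦR.map (𝟙 A)).hom x.2 = x.2
    rw [ΦR.map_id, CommMonCat.hom_id]
    exact gpMap_id_apply x.2
  map_comp f g := by
    apply CommMonCat.hom_ext
    refine MonoidHom.ext fun x => Prod.ext rfl ?_
    change Literature.AlgebraicGeometry.Frobenioids.gpMap (ΦR.map (f ≫ g)).hom x.2 =
      Literature.AlgebraicGeometry.Frobenioids.gpMap (ΦR.map g).hom
        (Literature.AlgebraicGeometry.Frobenioids.gpMap (ΦR.map f).hom x.2)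
    rw [ΦR.map_comp, CommMonCat.hom_comp, Literature.AlgebraicGeometry.Frobenioids.gpMap_comp]
    rfl

/-- Def. 3.3 (iii) data: `Φ₀ = ℚ≥0`, `B₀ = ℤ × (ℚ≥0)^gp`, `div₀ = pr₂`, `F₀ = B₀`, no cusps. [cite: MochizukiEtTh2009, Def 3.3 p.73] -/
def divisorMonoids : DivisorMonoids.{0, 0, 0} D where
  Φ₀ := ΦR
  B₀ := BΛ
  isUnit_B₀ _ b := by
    change IsUnit (M := Multiplicative ℤ × Algebra.GrothendieckGroup W) b
    exact Group.isUnit _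
  div₀ _ := MonoidHom.snd _ _
  div₀_natural _ _ := rfl
  F₀ _ := ⊤
  F₀_map _ _ _ := trivial
  ncsp₀ _ := ⊤
  csp₀ _ := ⊥
  ncsp₀_map _ _ _ := trivial
  csp₀_map _ x hx := by
    rw [Submonoid.mem_bot] at hx ⊢
    rw [hx, map_one]
  existsUnique_ncsp_csp _ x := by
    refine ⟨(⟨x, trivial⟩, ⟨1, Submonoid.mem_bot.mpr rfl⟩), mul_one x, ?_⟩
    rintro ⟨a, c⟩ h
    have hc : c.1 = 1 := Submonoid.mem_bot.mp c.2
    have ha : a.1 = x := by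
      have h' : a.1 * c.1 = x := h
      rwa [hc, mul_one] at h'
    exact Prod.ext (Subtype.ext ha) (Subtype.ext hc)

/-- Def. 3.6 (i) data (`Λ = ℚ`, `Φ₀^ℝ = Φ₀ = ℚ≥0`, `B₀^Λ = B₀`, `ℝ·Φ₀^cnst = ⊤`), trivial vocabulary. [cite: MochizukiEtTh2009, Def 3.6 p.76] -/
def realified : RealifiedDivisorMonoids (D₀ := D) Toy.monoidVocab where
  toDivisorMonoids := divisorMonoids
  Λ := MonoidType.Q
  ΦR := ΦR
  toR _ := MonoidHom.id _
  toR_natural _ _ := rfl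
  isRealification _ := trivial
  BΛ := BΛ
  isUnit_BΛ _ b := by
    change IsUnit (M := Multiplicative ℤ × Algebra.GrothendieckGroup W) b
    exact Group.isUnit _
  divΛ _ := MonoidHom.snd _ _
  divΛ_natural _ _ := rfl
  FΛ _ := ⊤
  FΛ_map _ _ _ := trivial
  cnstR _ := ⊤
  cnstR_map _ _ _ := trivial
  divΛ_mem_cnstR _ _ _ := trivial
  cnstR_root _ _ _ _ := trivial
  cnst_le_cnstR _ _ _ := trivial
  ncspR _ := ⊤
  cspR _ := ⊥
  toR_ncsp _ _ _ := trivial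
  toR_csp _ _ hx := hx

/-- The trivial [FrdI] category vocabulary on `B(M)`. [cite: MochizukiEtTh2009, Def 3.6 p.77] -/
def catVocab : FrdICatStub.{0, 0, 0} D where
  IsDivisorialOn _ := True
  IsRational _ := True
  IsStrictlyRational _ := True

/-- A submonoid of `ℚ≥0` which is everything is `ℚ`-monoprime. [cite: MochizukiEtTh2009, Def 3.6 p.77] -/
theorem isMonoprime_of_eq_top {S : Submonoid W} (hS : S = ⊤) : IsMonoprime ↥S := by
  subst hS
  exact IsMonoprime.ofQ ⟨⟨Submonoid.topEquiv⟩⟩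

/-- **The typed tempered Frobenioid of the certificate** (`D = D₀ = B(ℤ ⋊ ℕ≥1)`, `Φ = Φ^{ℝ-log} = ℚ≥0`,
`Φ^{bs-fld} = ℚ≥0` ℚ-monoprime, Def. 3.6 (ii)(b) by the constant `(0, 1)` with divisor `1 ≠ 0`).
[cite: MochizukiEtTh2009, Def 3.6 p.77] -/
def C : TemperedFrobenioid realified D catVocab where
  isConnected := zigzag_isConnected fun _ _ => Relation.ReflTransGen.refl
  isTotallyEpimorphic := isTotallyEpimorphic
  base := 𝟭 _
  Φ := ⟨fun _ => ⊤, fun _ _ _ => trivial⟩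
  isGroupSaturated A := (isGroupSaturated_iff' _).2 fun _ _ _ _ _ _ => trivial
  isPerfFactorial _ := trivial
  isDivisorialOn := trivial
  isMonoprime_bsFld A := isMonoprime_of_eq_top
    (eq_top_iff.2 fun x _ => Submonoid.mem_inf.2 ⟨Submonoid.mem_top x,
      (Subgroup.mem_top (Algebra.GrothendieckGroup.of x) :
        Algebra.GrothendieckGroup.of x ∈ (⊤ : Subgroup (Algebra.GrothendieckGroup W)))⟩)
  exists_FΛ_div_ne A := by
    refine ⟨((1 : Multiplicative ℤ), Algebra.GrothendieckGroup.of (Multiplicative.ofAdd (1 : ℚ≥0))), trivial,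
      (Multiplicative.ofAdd (1 : ℚ≥0) : W), trivial, (1 : W), trivial,
      fun h => one_ne_zero (Multiplicative.ofAdd.injective h), ?_⟩
    change Algebra.GrothendieckGroup.of (M := W) (Multiplicative.ofAdd 1) =
      Algebra.GrothendieckGroup.of (M := W) (Multiplicative.ofAdd 1) / Algebra.GrothendieckGroup.of (M := W) 1
    rw [(Algebra.GrothendieckGroup.of (M := W)).map_one, div_one]

/-- `B` is objectwise group-like. [cite: MochizukiEtTh2009, Def 3.6 p.77] -/
theorem hBg : Objectwise (fun N _ => IsGroupLike N) C.ratFnFunctor := C.ratFnFunctor_isGroupLike realified.isUnit_BΛ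

/-- The Frobenius-trivial object `X₀ = (•, 0)`. [cite: MochizukiFrdI2008, Thm. 5.2 (i) p.100] -/
def X₀ : C.category := ⟨SingleObj.star M, 1⟩

/-- The endomorphism `(d, g, w, k)` of `X₀` (degree `d`, base `g`, divisor `w`, unit part `k`). [cite: MochizukiFrdI2008, Thm. 5.2 (i) p.100] -/
def mkEnd (d : ℕ+) (g : M) (w : ℚ≥0) (k : ℤ) : X₀ ⟶ X₀ :=
  ModelFrobenioid.mkHom X₀ X₀ d g ⟨Multiplicative.ofAdd w, trivial⟩
    ⟨(((Multiplicative.ofAdd k, Algebra.GrothendieckGroup.of (Multiplicative.ofAdd w)) :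
        Multiplicative ℤ × Algebra.GrothendieckGroup W),
      Algebra.GrothendieckGroup.of (⟨Multiplicative.ofAdd w, trivial⟩ : C.Φ.carrier (op (SingleObj.star M)))), by
      change Algebra.GrothendieckGroup.of (M := W) (Multiplicative.ofAdd w) =
        gpMap (C.Φ.carrier (op (SingleObj.star M))).subtype (Algebra.GrothendieckGroup.of ⟨Multiplicative.ofAdd w, trivial⟩)
      rw [gpMap_of]; rfl⟩
    (by
      change (1 : Algebra.GrothendieckGroup (C.Φ.carrier (op (SingleObj.star M)))) ^ (d : ℕ) *
          Algebra.GrothendieckGroup.of ⟨Multiplicative.ofAdd w, trivial⟩ =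
        pullGp C.divisorMonoid g 1 * Algebra.GrothendieckGroup.of ⟨Multiplicative.ofAdd w, trivial⟩
      rw [one_pow, map_one]
      rfl)

/-- Components of `mkEnd`. [cite: MochizukiFrdI2008, Thm. 5.2 (i) p.100] -/
@[simp] theorem degFr_mkEnd (d : ℕ+) (g : M) (w : ℚ≥0) (k : ℤ) : ModelFrobenioid.degFr (mkEnd d g w k) = d := rfl

/-- Components of `mkEnd`. [cite: MochizukiFrdI2008, Thm. 5.2 (i) p.100] -/
@[simp] theorem baseMap_mkEnd (d : ℕ+) (g : M) (w : ℚ≥0) (k : ℤ) : ModelFrobenioid.baseMap (mkEnd d g w k) = g := rfl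

/-- `Base(X₀) = •`, `cls(X₀) = 0`. [cite: MochizukiFrdI2008, Thm. 5.2 (i) p.100] -/
@[simp] theorem X₀_cls : X₀.cls = 1 := rfl

/-- The identity of `X₀` in coordinates. [cite: MochizukiFrdI2008, Thm. 5.2 (i) p.100] -/
theorem mkEnd_one : mkEnd 1 ⟨0, 1⟩ 0 0 = 𝟙 X₀ := by
  refine ModelFrobenioid.hom_ext rfl rfl (Subtype.ext rfl) (Subtype.ext (Prod.ext (Prod.ext rfl ?_) ?_))
  · exact (Algebra.GrothendieckGroup.of (M := W)).map_one
  · exact (Algebra.GrothendieckGroup.of (M := C.Φ.carrier (op (SingleObj.star M)))).map_one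

/-- **Composition of endomorphisms of `X₀` in coordinates** `(d₂d₁, g₂g₁, w₂/n₁ + d₂w₁, k₂ + d₂k₁)`. [cite: MochizukiFrdI2008, Thm. 5.2 (i) p.100] -/
theorem mkEnd_comp (d₁ d₂ : ℕ+) (g₁ g₂ : M) (w₁ w₂ : ℚ≥0) (k₁ k₂ : ℤ) :
    mkEnd d₁ g₁ w₁ k₁ ≫ mkEnd d₂ g₂ w₂ k₂ =
      mkEnd (d₂ * d₁) (g₂ * g₁) (ninv g₁ * w₂ + ((d₂ : ℕ) : ℚ≥0) * w₁) (k₂ + ((d₂ : ℕ) : ℤ) * k₁) := by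
  refine ModelFrobenioid.hom_ext rfl rfl (Subtype.ext (scale_mul_pow _ _ _ _))
    (Subtype.ext (Prod.ext (Prod.ext ?_ ?_) ?_))
  · show Multiplicative.ofAdd k₂ * Multiplicative.ofAdd k₁ ^ (d₂ : ℕ) = Multiplicative.ofAdd (k₂ + ((d₂ : ℕ) : ℤ) * k₁)
    rw [← ofAdd_nsmul, ← ofAdd_add, nsmul_eq_mul]
  · show Literature.AlgebraicGeometry.Frobenioids.gpMap _ (Algebra.GrothendieckGroup.of (Multiplicative.ofAdd w₂)) *
        Algebra.GrothendieckGroup.of (Multiplicative.ofAdd w₁) ^ (d₂ : ℕ) = Algebra.GrothendieckGroup.of _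
    rw [Literature.AlgebraicGeometry.Frobenioids.gpMap_of, ← map_pow, ← map_mul]
    exact congrArg _ (scale_mul_pow _ _ _ _)
  · show gpMap _ (Algebra.GrothendieckGroup.of _) * Algebra.GrothendieckGroup.of _ ^ (d₂ : ℕ) = Algebra.GrothendieckGroup.of _
    rw [gpMap_of, ← map_pow, ← map_mul]
    exact congrArg _ (Subtype.ext (scale_mul_pow _ _ _ _))

/-- Congruence for `mkEnd`. [cite: MochizukiFrdI2008, Thm. 5.2 (i) p.100] -/
theorem mkEnd_congr {d d' : ℕ+} {g g' : M} {w w' : ℚ≥0} {k k' : ℤ} (hd : d = d') (hg : g = g') (hw : w = w')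
    (hk : k = k') : mkEnd d g w k = mkEnd d' g' w' k' := by
  subst hd hg hw hk; rfl

section Coordinates

variable {X Y Z : C.category}

/-- The zero divisor `w ∈ ℚ≥0` of an arrow. [cite: MochizukiFrdI2008, Thm. 5.2 (i) p.100] -/
def wOf (φ : X ⟶ Y) : ℚ≥0 := Multiplicative.toAdd ((ModelFrobenioid.div φ).1 : W)

/-- The unit part `k ∈ ℤ` of the rational function of an arrow. [cite: MochizukiFrdI2008, Thm. 5.2 (i) p.100] -/
def kOf (φ : X ⟶ Y) : ℤ := Multiplicative.toAdd ((ModelFrobenioid.unit φ).1.1.1 : Multiplicative ℤ)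

/-- `w(φ;ψ) = w_ψ/n_φ + m_ψ·w_φ`. [cite: MochizukiFrdI2008, Thm. 5.2 (i) p.100] -/
theorem wOf_comp (φ : X ⟶ Y) (ψ : Y ⟶ Z) :
    wOf (φ ≫ ψ) = ninv (ModelFrobenioid.baseMap φ) * wOf ψ + ((ModelFrobenioid.degFr ψ : ℕ) : ℚ≥0) * wOf φ := by
  let a : W := (ModelFrobenioid.div ψ).1
  let b : W := (ModelFrobenioid.div φ).1
  have h : wOf (φ ≫ ψ) =
      Multiplicative.toAdd (scale (ninv (ModelFrobenioid.baseMap φ)) a * b ^ (ModelFrobenioid.degFr ψ : ℕ)) := rfl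
  rw [h, toAdd_mul, toAdd_pow, scale_apply, toAdd_ofAdd, nsmul_eq_mul]
  rfl

/-- `k(φ;ψ) = k_ψ + m_ψ·k_φ`. [cite: MochizukiFrdI2008, Thm. 5.2 (i) p.100] -/
theorem kOf_comp (φ : X ⟶ Y) (ψ : Y ⟶ Z) :
    kOf (φ ≫ ψ) = kOf ψ + ((ModelFrobenioid.degFr ψ : ℕ) : ℤ) * kOf φ := by
  show Multiplicative.toAdd ((ModelFrobenioid.unit ψ).1.1.1 * (ModelFrobenioid.unit φ).1.1.1 ^ (ModelFrobenioid.degFr ψ : ℕ)) = _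
  rw [toAdd_mul, toAdd_pow, nsmul_eq_mul]
  rfl

/-- The `Φ^gp`-component of the rational function of an arrow is determined by the relation (d).
[cite: MochizukiFrdI2008, Thm. 5.2 (i) p.100] -/
theorem unit_snd_eq (φ : X ⟶ Y) :
    (ModelFrobenioid.unit φ).1.2 = (pullGp C.divisorMonoid (ModelFrobenioid.baseMap φ) Y.cls)⁻¹ *
      (X.cls ^ (ModelFrobenioid.degFr φ : ℕ) * Algebra.GrothendieckGroup.of (ModelFrobenioid.div φ)) :=
  eq_inv_mul_of_mul_eq (ModelFrobenioid.rel φ).symm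

/-- The `B₀^Λ`-divisor component of the rational function is the image of its `Φ^gp`-component (membership in
`B = B₀^Λ ×_{(Φ^{ℝ-log})^gp} Φ^gp`). [cite: MochizukiEtTh2009, Def 3.6 p.77] -/
theorem unit_fst_snd_eq (φ : X ⟶ Y) :
    (ModelFrobenioid.unit φ).1.1.2 = C.ΦgpToRlog _ (ModelFrobenioid.unit φ).1.2 :=
  (ModelFrobenioid.unit φ).2

end Coordinates

section HomOf

variable (X Y : C.category) (d : ℕ+) (g : X.base ⟶ Y.base) (z : C.divisorMonoid.obj (op X.base)) (u : ℤ)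

/-- The `Φ^gp`-component of a rational function forced by relation (d) for the data `(d, g, z)`.
[cite: MochizukiFrdI2008, Thm. 5.2 (i) p.100] -/
def ξOf : Algebra.GrothendieckGroup (C.divisorMonoid.obj (op X.base)) :=
  (pullGp C.divisorMonoid g Y.cls)⁻¹ * (X.cls ^ (d : ℕ) * Algebra.GrothendieckGroup.of z)

/-- The rational function `((u, ·), ξ)` with unit part `u` over the forced `Φ^gp`-component. [cite: MochizukiEtTh2009, Def 3.6 p.77] -/
def bOf : C.ratFn (op X.base) :=
  ⟨((Multiplicative.ofAdd u, C.ΦgpToRlog _ (ξOf X Y d g z)), ξOf X Y d g z), rfl⟩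

/-- Relation (d) holds for `bOf`. [cite: MochizukiFrdI2008, Thm. 5.2 (i) p.100] -/
theorem rel_bOf : X.cls ^ (d : ℕ) * Algebra.GrothendieckGroup.of z =
    pullGp C.divisorMonoid g Y.cls * divB C.divisorMonoid C.ratFnFunctor C.divBNatTrans (op X.base) (bOf X Y d g z u) :=
  (mul_inv_cancel_left _ _).symm

/-- The arrow `X ⟶ Y` with data `(d, g, z)` and unit part `u`. [cite: MochizukiFrdI2008, Thm. 5.2 (i) p.100] -/
def homOf : X ⟶ Y := ModelFrobenioid.mkHom X Y d g z (bOf X Y d g z u) (rel_bOf X Y d g z u)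

end HomOf

end DegreeSwap

end Literature.AnabelianGeometry.EtaleTheta

end
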